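import Summits.QuantumFields.YangMills.Theorems.BalabanLadderIRPinnedExitRateForm
import Summits.QuantumFields.YangMills.Theorems.BalabanLadderIRColdPurityBridgeRungs
import HarnessLib

/-!
# Crux `BalabanLadder.IR` ∕ `IRcof` (stmt-QuantumFields-19354 ∕ 26930): THE NUMBER in TRANSFER-MATRIX currency —
# PX(1/24) ↔ «the thermal multiplicity `tr T̂ᵗ − 1` of every spatial torus beyond `T` floor-lengths decays at a rate `≥ c` in floor units»
# (helper; LEAD prover ym-ir-line-ab-p1 gen 8, slot custody; def-free calibration)

HONEST STATUS.  Bookkeeping over the landed spectral dictionary (`traceExcess` ↔ cold defect) and the landed rate form; nothing here proves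
PX(1/24), PXcof(1/24) (THE NUMBER), `BalabanLadder.IR` (19354), `IRcof` (26930), or the Clay Yang–Mills mass gap (NOT proved anywhere in this
tree; R4 = the conditional finite-𝕋⁴ rung `BalabanLadder.UV` only).  Width 0 toward the stubs.

The slots of record register `stub_pinnedExit96 : PinnedExit96.PinnedExitAt (1/24)` (19354) and `stub_pinnedExitsCofinal : PinnedExitsCofinalAt (1/24)`
(26930).  `BalabanLadderIRPinnedExitRateForm` (gen 7) re-typed both as an exponential PURITY law `δᶜ_β(P) ≤ exp(−c·a(β)·P)` on every cold `4:1`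
box with `a(β)·P ≥ T`.  THIS FILE moves that law to Lüscher's transfer matrix: with `x_t(P) := traceExcess r.ρ β P t = Z_β(t × P³)/λ₊(β,P)ᵗ − 1
= Σ_{i ≠ 0} (λᵢ/λ₊)ᵗ` (the thermal multiplicity of the spatial torus `P³` at Euclidean time `t`; `Literature…WilsonTransferKernel`),

* `traceExcessRate_of_defectRate` (model side, one coupling `β ≥ 0`, floor scale `0 < s ≤ 1`): the purity law `δᶜ_β(P) ≤ exp(−c·s·P)` on
  `s·P ≥ T` forces `x_t(P) ≤ exp(−2c·s·t)` for EVERY spatial torus with `s·P ≥ max T (2 log 2/c + 3)` and EVERY time `t ≥ ⌊P/4⌋` — dictionary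
  `DoublingDefect.traceExcess_le_of_coldDefect_le` (`x_{⌊P/4⌋} ≤ 2δᶜ`) + propagation to colder shapes `DoublingDefect.traceExcess_le_exp_of_le`;
  `defectRate_of_traceExcessRate`: conversely `x_{⌊P/4⌋}(P) ≤ exp(−c·s·⌊P/4⌋)` on `s·P ≥ T` gives back `δᶜ_β(P) ≤ exp(−(c/8)·s·P)` on
  `s·P ≥ max T (8 log 2/c + 8)` (`ColdPurityBridge.one_sub_ratio_le_two_mul_traceExcess`: `δᶜ ≤ 2x_{⌊P/4⌋}`).
* `pinnedExitAt24_iff_traceExcessForm` — **PX(1/24) ↔ TRANSFER-MATRIX FORM**: under the crux's own hypotheses (`a > 0`, `a → 0`, `LowerBounds G r a`)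
  there are `T, c > 0, β₁` with `x_t(P) ≤ exp(−c·a(β)·t)` for ALL `β ≥ β₁`, ALL spatial tori `P` with `a(β)·P ≥ T` and ALL Euclidean times `t ≥ ⌊P/4⌋`.
  In words: THE NUMBER says EXACTLY that on every spatial torus longer than `T` floor-lengths every excited transfer-matrix state lies at least
  `c·a(β)` above the vacuum (lattice units) AND the whole excited tower has thermal weight `≤ 1` from time `⌊P/4⌋` on — a finite-volume mass gap
  `≥ c` in floor units with its entropy, uniformly in the coupling.  This is the partition-function-side twin of the leaf's `GapInUnits` (rate `c₁·a(β)`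
  for truncated correlations of local observables), now stated on the same object (the spectrum of `T̂`) that `GapInUnits` is about.
* `pinnedExitsCofinalAt24_iff_traceExcessForm` — the same re-typing for the COFINAL slot PXcof(1/24) of 26930 (`∀ β₁ ∃ β ≥ β₁`; `T`, `c` before `β₁`).

READING (numbers, not adjectives): rate `c ↦ 2c` and pin `T ↦ max T (2 log 2/c + 3)` one way, `c ↦ c/8` and `T ↦ max T (8 log 2/c + 8)` back; composed
with the rate form's `2¹⁵T`, `1/(2¹⁴T)`.  No new definition; no hypothesis weakened or strengthened; the floor `LowerBounds` is carried, never used.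

References: tree `BalabanLadderIRPinnedExitRateForm` (LEAD g7), `DoublingDefectRecursionToGapSpectral` (dictionary), `BalabanLadderIRColdPurityBridgeRungs`
(`one_sub_ratio_le_two_mul_traceExcess`), `Literature/MathematicalPhysics/QuantumFieldTheory/WilsonTransferKernel` (`traceExcess`); M. Lüscher, Commun.
Math. Phys. 54 (1977) 283; K. Osterwalder, E. Seiler, Ann. Phys. 110 (1978) 440 (transfer matrix — background only, nothing cited as a fact).
-/

noncomputable section

open Filter Topology
open Literature.MathematicalPhysics.QuantumFieldTheory
open Summit.QuantumFields.YangMills.Cruxes.OSLegsFromFemtoAndGap.DlrCollarTransfer (LowerBounds)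
open Summit.QuantumFields.YangMills.Cruxes.IR.ColdPurityBridge (coldDefect one_sub_ratio_le_two_mul_traceExcess)
open Summit.QuantumFields.YangMills.Cruxes.IR.PinnedExit96 (PinnedExitAt)
open Summit.QuantumFields.YangMills.Theorems.DoublingDefect (traceExcess_le_of_coldDefect_le traceExcess_le_exp_of_le)
open Summit.QuantumFields.YangMills.Cruxes.IR.PinnedExit96.RateForm (eventually_le_of_tendsto_zero
  pinnedExitAt24_iff_rateForm pinnedExitsCofinalAt24_iff_rateForm)

namespace Summit.QuantumFields.YangMills.Cruxes.IR.PinnedExit96.TraceExcessForm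

/-! ## §0 Two real-number facts -/

/-- `exp(−A) ≤ 1/2` once `log 2 ≤ A`. -/
theorem exp_neg_le_half {A : ℝ} (hA : Real.log 2 ≤ A) : Real.exp (-A) ≤ 1 / 2 := by
  have h : Real.exp (-A) ≤ Real.exp (-Real.log 2) := Real.exp_le_exp.2 (by linarith)
  rw [Real.exp_neg (Real.log 2), Real.exp_log (by norm_num : (0 : ℝ) < 2)] at h
  rw [one_div]
  exact h

/-- `2·exp(−A) ≤ exp(−B)` once `log 2 + B ≤ A`. -/
theorem two_mul_exp_neg_le {A B : ℝ} (h : Real.log 2 + B ≤ A) : 2 * Real.exp (-A) ≤ Real.exp (-B) := by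
  have h2 : (2 : ℝ) = Real.exp (Real.log 2) := (Real.exp_log (by norm_num : (0 : ℝ) < 2)).symm
  rw [h2, ← Real.exp_add]
  exact Real.exp_le_exp.2 (by linarith)

/-! ## §1 Model side: one coupling, purity law ↔ thermal-multiplicity law in the pin's units -/

section Model

variable {G : Type} [Group G] [TopologicalSpace G] [IsTopologicalGroup G] [CompactSpace G]
  [MeasurableSpace G] [BorelSpace G]

/-- `⌊P/4⌋ = m + 2` brackets `P`: `4(m+2) ≤ P ≤ 4(m+2) + 3` (as reals). -/
theorem floor_bracket {P m : ℕ} (hPm : P / 4 = m + 2) :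
    4 * ((m + 2 : ℕ) : ℝ) ≤ (P : ℝ) ∧ (P : ℝ) ≤ 4 * ((m + 2 : ℕ) : ℝ) + 3 := by
  constructor
  · have h : 4 * (m + 2) ≤ P := by omega
    exact_mod_cast h
  · have h : P ≤ 4 * (m + 2) + 3 := by omega
    exact_mod_cast h

/-- **Thermal-multiplicity law from a purity law (PROVED, model side).**  At a coupling `β ≥ 0` with floor scale `0 < s ≤ 1`: if
`δᶜ_β(P) ≤ exp(−c·s·P)` for every box with `s·P ≥ T` (`c > 0`), then for every spatial torus `P` with `s·P ≥ max T (2 log 2/c + 3)`, `⌊P/4⌋ = m + 2`,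
and every Euclidean time `k + 2 ≥ m + 2`: `x_{k+2}(P) ≤ exp(−2c·s·(k+2))`. -/
theorem traceExcessRate_of_defectRate (r : LatticeRep G) {β s T c : ℝ} (hβ0 : 0 ≤ β) (hs : 0 < s) (hs1 : s ≤ 1) (hc : 0 < c)
    (hrate : ∀ P : ℕ, T ≤ s * (P : ℝ) → coldDefect r.ρ β P ≤ Real.exp (-(c * (s * (P : ℝ))))) :
    ∀ (P : ℕ) [NeZero P] (m k : ℕ), P / 4 = m + 2 → m ≤ k → max T (2 * Real.log 2 / c + 3) ≤ s * (P : ℝ) →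
      traceExcess r.ρ β P (k + 2) ≤ Real.exp (-(2 * c * s * ((k + 2 : ℕ) : ℝ))) := by
  intro P _ m k hPm hmk hP
  letI : MeasurableSpace G := ‹MeasurableSpace G›
  haveI : SecondCountableTopology G :=
    (r.continuous.isClosedEmbedding r.injective).isEmbedding.secondCountableTopology
  have hT : T ≤ s * (P : ℝ) := le_trans (le_max_left _ _) hP
  have hP3 : 2 * Real.log 2 / c + 3 ≤ s * (P : ℝ) := le_trans (le_max_right _ _) hP
  have hlog2 : 0 < Real.log 2 := Real.log_pos (by norm_num)
  obtain ⟨hlo, hhi⟩ := floor_bracket hPm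
  -- the purity law at `P`, and `η := exp(−c s P) ≤ 1/2`
  have hδ := hrate P hT
  have hcsP : 2 * Real.log 2 + 3 * c ≤ c * (s * (P : ℝ)) := by
    have h := mul_le_mul_of_nonneg_left hP3 hc.le
    have heq : c * (2 * Real.log 2 / c + 3) = 2 * Real.log 2 + 3 * c := by field_simp
    linarith [heq]
  have hη : Real.exp (-(c * (s * (P : ℝ)))) ≤ 1 / 2 := exp_neg_le_half (by nlinarith)
  -- dictionary: `x_{m+2}(P) ≤ 2η`
  have hδ' : 1 - wilsonFinTorusPartition r.ρ β P P P (2 * (m + 2)) / wilsonFinTorusPartition r.ρ β P P P (m + 2) ^ 2 ≤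
      Real.exp (-(c * (s * (P : ℝ)))) := by
    have h := hδ
    simp only [coldDefect, hPm] at h
    exact h
  have hx := traceExcess_le_of_coldDefect_le r.continuous r.mem_unitary hβ0 P m hη hδ'
  -- `2η ≤ exp(−2cs(m+2))`: `log 2 + 2cs(m+2) ≤ csP` since `4(m+2) ≥ P − 3` and `s(P−3) ≥ 2 log 2/c`
  have hcs : 0 < c * s := mul_pos hc hs
  have h₀ : traceExcess r.ρ β P (m + 2) ≤ Real.exp (-(2 * c * s * ((m + 2 : ℕ) : ℝ))) := by
    refine hx.trans (two_mul_exp_neg_le ?_)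
    -- goal: log 2 + 2cs(m+2) ≤ c (s P)
    have h1 : c * s * ((P : ℝ) - 3) ≤ 4 * (c * s) * ((m + 2 : ℕ) : ℝ) := by nlinarith
    have h2 : 2 * Real.log 2 ≤ c * s * ((P : ℝ) - 3) := by nlinarith
    nlinarith
  -- propagate to colder shapes
  have h₀' : traceExcess r.ρ β P (m + 2) ≤ Real.exp (-((2 * c * s) * ((m + 2 : ℕ) : ℝ))) := by
    simpa [mul_assoc] using h₀
  have h := traceExcess_le_exp_of_le r.continuous r.mem_unitary hβ0 P hmk h₀'
  simpa [mul_assoc] using h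

/-- **Purity law from a thermal-multiplicity law (PROVED, model side).**  At a coupling `β ≥ 0` with floor scale `0 < s ≤ 1`: if
`x_{⌊P/4⌋}(P) ≤ exp(−c·s·⌊P/4⌋)` for every spatial torus with `s·P ≥ T` (`c > 0`; `⌊P/4⌋ = m + 2`), then `δᶜ_β(P) ≤ exp(−(c/8)·s·P)` for every
box with `s·P ≥ max T (8 log 2/c + 8)`. -/
theorem defectRate_of_traceExcessRate (r : LatticeRep G) {β s T c : ℝ} (hβ0 : 0 ≤ β) (hs : 0 < s) (hs1 : s ≤ 1) (hc : 0 < c)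
    (hx : ∀ (P : ℕ) [NeZero P] (m : ℕ), P / 4 = m + 2 → T ≤ s * (P : ℝ) →
      traceExcess r.ρ β P (m + 2) ≤ Real.exp (-(c * s * ((m + 2 : ℕ) : ℝ)))) :
    ∀ P : ℕ, max T (8 * Real.log 2 / c + 8) ≤ s * (P : ℝ) → coldDefect r.ρ β P ≤ Real.exp (-(c / 8 * (s * (P : ℝ)))) := by
  intro P hP
  have hT : T ≤ s * (P : ℝ) := le_trans (le_max_left _ _) hP
  have hP8 : 8 * Real.log 2 / c + 8 ≤ s * (P : ℝ) := le_trans (le_max_right _ _) hP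
  have hlog2 : 0 < Real.log 2 := Real.log_pos (by norm_num)
  -- `P ≥ 8` (from `s ≤ 1`), hence `⌊P/4⌋ = m + 2`
  have hP8' : (8 : ℝ) ≤ (P : ℝ) := by
    have h1 : (8 : ℝ) ≤ s * (P : ℝ) := by
      have : 0 < 8 * Real.log 2 / c := by positivity
      linarith
    have hP0 : (0 : ℝ) ≤ (P : ℝ) := by positivity
    nlinarith
  have hP8n : 8 ≤ P := by exact_mod_cast hP8'
  haveI : NeZero P := ⟨by omega⟩
  obtain ⟨m, hPm⟩ : ∃ m : ℕ, P / 4 = m + 2 := ⟨P / 4 - 2, by omega⟩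
  obtain ⟨hlo, hhi⟩ := floor_bracket hPm
  -- `δᶜ(P) ≤ 2 x_{m+2}(P) ≤ 2 exp(−cs(m+2)) ≤ exp(−(c/8) s P)`
  have h1 : coldDefect r.ρ β P ≤ 2 * traceExcess r.ρ β P (m + 2) := by
    have h := one_sub_ratio_le_two_mul_traceExcess r hβ0 P m
    simp only [coldDefect, hPm]
    exact h
  have h2 := hx P m hPm hT
  refine h1.trans ((mul_le_mul_of_nonneg_left h2 (by norm_num)).trans (two_mul_exp_neg_le ?_))
  -- goal: log 2 + c/8 (s P) ≤ c s (m+2), from `4(m+2) ≥ P − 3` and `sP ≥ 8 log 2/c + 8 ≥ 8 log 2/c + 6s`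
  have hcs : 0 < c * s := mul_pos hc hs
  have h3 : c * s * ((P : ℝ) - 3) ≤ 4 * (c * s * ((m + 2 : ℕ) : ℝ)) := by nlinarith
  have h4 : 8 * Real.log 2 + 8 * c ≤ c * (s * (P : ℝ)) := by
    have h := mul_le_mul_of_nonneg_left hP8 hc.le
    have heq : c * (8 * Real.log 2 / c + 8) = 8 * Real.log 2 + 8 * c := by field_simp
    linarith [heq]
  have h5 : c * s ≤ c := by nlinarith
  nlinarith

end Model

/-! ## §2 PX(1/24) ↔ TRANSFER-MATRIX FORM (slot of record on 19354) -/

/-- **PX(1/24) ↔ TRANSFER-MATRIX (thermal-multiplicity) FORM (PROVED): THE NUMBER is a β-uniform mass gap `≥ c` in floor units, entropy included,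
on every spatial torus beyond `T` floor-lengths — `tr T̂ᵗ − 1 ≤ exp(−c·a(β)·t)` for all `t ≥ ⌊P/4⌋`.** -/
theorem pinnedExitAt24_iff_traceExcessForm :
    PinnedExitAt (1 / 24) ↔
    ∀ (G : Type) [Group G] [TopologicalSpace G] [IsTopologicalGroup G] [CompactSpace G],
      IsCompactSimpleLieGroup G → SimplyConnectedSpace G →
      letI : MeasurableSpace G := borel G
      haveI : BorelSpace G := ⟨rfl⟩
      ∀ (r : LatticeRep G) (a : ℝ → ℝ), (∀ β, 0 < a β) → Tendsto a atTop (𝓝 0) → LowerBounds G r a →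
        ∃ T c β₁ : ℝ, 0 < c ∧ ∀ β : ℝ, β₁ ≤ β → ∀ (P : ℕ) [NeZero P] (m k : ℕ), P / 4 = m + 2 → m ≤ k →
          T ≤ a β * (P : ℝ) → traceExcess r.ρ β P (k + 2) ≤ Real.exp (-(c * a β * ((k + 2 : ℕ) : ℝ))) := by
  rw [pinnedExitAt24_iff_rateForm]
  constructor
  · intro hR G _ _ _ _ hG hsc
    letI : MeasurableSpace G := borel G
    haveI : BorelSpace G := ⟨rfl⟩
    intro r a ha ha0 hlb
    obtain ⟨T, c, β₁, hc, hrate⟩ := hR G hG hsc r a ha ha0 hlb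
    obtain ⟨βa, hβa⟩ := eventually_le_of_tendsto_zero ha0 one_pos
    refine ⟨max T (2 * Real.log 2 / c + 3), 2 * c, max (max β₁ βa) 0, by positivity, ?_⟩
    intro β hβ P _ m k hPm hmk hP
    have hβ1 : β₁ ≤ β := le_trans (le_trans (le_max_left _ _) (le_max_left _ _)) hβ
    have hβa' : βa ≤ β := le_trans (le_trans (le_max_right _ _) (le_max_left _ _)) hβ
    have hβ0 : (0 : ℝ) ≤ β := le_trans (le_max_right _ _) hβ
    have h := traceExcessRate_of_defectRate r hβ0 (ha β) (hβa β hβa') hc (hrate β hβ1) P m k hPm hmk hP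
    simpa [mul_assoc] using h
  · intro hX G _ _ _ _ hG hsc
    letI : MeasurableSpace G := borel G
    haveI : BorelSpace G := ⟨rfl⟩
    intro r a ha ha0 hlb
    obtain ⟨T, c, β₁, hc, hx⟩ := hX G hG hsc r a ha ha0 hlb
    obtain ⟨βa, hβa⟩ := eventually_le_of_tendsto_zero ha0 one_pos
    refine ⟨max T (8 * Real.log 2 / c + 8), c / 8, max (max β₁ βa) 0, by positivity, ?_⟩
    intro β hβ P hP
    have hβ1 : β₁ ≤ β := le_trans (le_trans (le_max_left _ _) (le_max_left _ _)) hβ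
    have hβa' : βa ≤ β := le_trans (le_trans (le_max_right _ _) (le_max_left _ _)) hβ
    have hβ0 : (0 : ℝ) ≤ β := le_trans (le_max_right _ _) hβ
    have hx' : ∀ (P : ℕ) [NeZero P] (m : ℕ), P / 4 = m + 2 → T ≤ a β * (P : ℝ) →
        traceExcess r.ρ β P (m + 2) ≤ Real.exp (-(c * a β * ((m + 2 : ℕ) : ℝ))) :=
      fun P _ m hPm hT => hx β hβ1 P m m hPm le_rfl hT
    have h := defectRate_of_traceExcessRate r hβ0 (ha β) (hβa β hβa') hc
      (fun P _ m hPm hT => by simpa [mul_assoc] using hx' P m hPm hT) P hP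
    simpa [mul_assoc] using h

/-! ## §3 PXcof(1/24) (slot of record on 26930): the cofinal body has the same re-typing

The body of `PinnedExitsCofinalAt (1/24)` is spelled out verbatim (its `def` lives in the slot's `Lines/` workfile; cf. `BalabanLadderIRPinnedExitRateForm` §4). -/

/-- **PXcof(1/24) ↔ COFINAL TRANSFER-MATRIX FORM (PROVED)**: `∃ T, c > 0` such that for every `β₁` some `β ≥ β₁` obeys `x_t(P) ≤ exp(−c·a(β)·t)` on every
spatial torus with `a(β)·P ≥ T` and every time `t ≥ ⌊P/4⌋`. -/
theorem pinnedExitsCofinalAt24_iff_traceExcessForm :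
    (∀ (G : Type) [Group G] [TopologicalSpace G] [IsTopologicalGroup G] [CompactSpace G],
      IsCompactSimpleLieGroup G → SimplyConnectedSpace G →
      letI : MeasurableSpace G := borel G
      haveI : BorelSpace G := ⟨rfl⟩
      ∀ (r : LatticeRep G) (a : ℝ → ℝ), (∀ β, 0 < a β) → Tendsto a atTop (𝓝 0) → LowerBounds G r a →
        ∃ T : ℝ, ∀ β₁ : ℝ, ∃ β : ℝ, β₁ ≤ β ∧ ∃ L : ℕ, 8 ≤ L ∧ a β * (L : ℝ) ≤ T ∧ coldDefect r.ρ β L ≤ 1 / 24) ↔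
    ∀ (G : Type) [Group G] [TopologicalSpace G] [IsTopologicalGroup G] [CompactSpace G],
      IsCompactSimpleLieGroup G → SimplyConnectedSpace G →
      letI : MeasurableSpace G := borel G
      haveI : BorelSpace G := ⟨rfl⟩
      ∀ (r : LatticeRep G) (a : ℝ → ℝ), (∀ β, 0 < a β) → Tendsto a atTop (𝓝 0) → LowerBounds G r a →
        ∃ T c : ℝ, 0 < c ∧ ∀ β₁ : ℝ, ∃ β : ℝ, β₁ ≤ β ∧ ∀ (P : ℕ) [NeZero P] (m k : ℕ), P / 4 = m + 2 → m ≤ k →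
          T ≤ a β * (P : ℝ) → traceExcess r.ρ β P (k + 2) ≤ Real.exp (-(c * a β * ((k + 2 : ℕ) : ℝ))) := by
  rw [pinnedExitsCofinalAt24_iff_rateForm]
  constructor
  · intro hR G _ _ _ _ hG hsc
    letI : MeasurableSpace G := borel G
    haveI : BorelSpace G := ⟨rfl⟩
    intro r a ha ha0 hlb
    obtain ⟨T, c, hc, hrate⟩ := hR G hG hsc r a ha ha0 hlb
    obtain ⟨βa, hβa⟩ := eventually_le_of_tendsto_zero ha0 one_pos
    refine ⟨max T (2 * Real.log 2 / c + 3), 2 * c, by positivity, fun β₁ => ?_⟩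
    obtain ⟨β, hβ, hrb⟩ := hrate (max (max β₁ βa) 0)
    have hβ1 : β₁ ≤ β := le_trans (le_trans (le_max_left _ _) (le_max_left _ _)) hβ
    have hβa' : βa ≤ β := le_trans (le_trans (le_max_right _ _) (le_max_left _ _)) hβ
    have hβ0 : (0 : ℝ) ≤ β := le_trans (le_max_right _ _) hβ
    refine ⟨β, hβ1, ?_⟩
    intro P _ m k hPm hmk hP
    have h := traceExcessRate_of_defectRate r hβ0 (ha β) (hβa β hβa') hc hrb P m k hPm hmk hP
    simpa [mul_assoc] using h
  · intro hX G _ _ _ _ hG hsc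
    letI : MeasurableSpace G := borel G
    haveI : BorelSpace G := ⟨rfl⟩
    intro r a ha ha0 hlb
    obtain ⟨T, c, hc, hx⟩ := hX G hG hsc r a ha ha0 hlb
    obtain ⟨βa, hβa⟩ := eventually_le_of_tendsto_zero ha0 one_pos
    refine ⟨max T (8 * Real.log 2 / c + 8), c / 8, by positivity, fun β₁ => ?_⟩
    obtain ⟨β, hβ, hxb⟩ := hx (max (max β₁ βa) 0)
    have hβ1 : β₁ ≤ β := le_trans (le_trans (le_max_left _ _) (le_max_left _ _)) hβ
    have hβa' : βa ≤ β := le_trans (le_trans (le_max_right _ _) (le_max_left _ _)) hβ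
    have hβ0 : (0 : ℝ) ≤ β := le_trans (le_max_right _ _) hβ
    refine ⟨β, hβ1, ?_⟩
    intro P hP
    have h := defectRate_of_traceExcessRate r hβ0 (ha β) (hβa β hβa') hc
      (fun P _ m hPm hT => by simpa [mul_assoc] using hxb P m m hPm le_rfl hT) P hP
    simpa [mul_assoc] using h

end Summit.QuantumFields.YangMills.Cruxes.IR.PinnedExit96.TraceExcessForm

end
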